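import Summits.NavierStokesRegularity.NavierStokesRegularity.Theorems.SqueezeCycleExtremalElementExistsRegularity
import HarnessLib

/-!
# Uniform regularity of bounded Oseen-mild fields on two-sided time windows
# (crux `TypeIliouvilleNoTypeII`, stmt-NavierStokesRegularity-0056, line `Sketch`, stub
# `stub_activeWindowsGenerateNonconstant`)

Helper file (theorems only) for the two-sided ("immortal") zoom of the line. It is the bounded
twin of the tree's `SqueezeCycleSingularZoomWindow` (there: Type-I fields on final windows
`(A, 0)`; here: fields bounded by a constant `N` on an arbitrary open time window `(A, B)`).
A field `u : ℝ → ℝ³ → ℝ³` which is jointly continuous on `(A, B) × ℝ³`, has weakly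
divergence-free slices there, satisfies the Oseen integral equation
`u t x = e^{(t-s)Δ}u(s)(x) - B¹_s(u,u)(t)(x)` for all `A < s < t < B`, and obeys `‖u(t,x)‖ ≤ N` for
`A < t < B`, is — after a time shift and a clamp — a restarted bounded mild field of KNSS 2009, §4
on every window `(a, b)`, `A < a < b < B` (`isKNSSDriftMild_window_of_bounded`). Consequently
(KNSS 2009, Prop. 4.1 in the tree's rendering `KNSS2009_prop41_mild_holds`,
`KNSSBootstrap.exists_norm_iteratedFDeriv_slice_le`, `KNSSBootstrap.exists_lipschitz_time_iteratedFDeriv`)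
it is jointly `C^∞` on `(A, B) × ℝ³` (`contDiffOn_of_bounded`), divergence free there
(`isDivFree_of_bounded`), and for every order `k`, window `a < b` and margin `δ > 0` there are
constants depending on `k, a, b, δ, N` only bounding `‖Dᵏu(t)(x)‖` on `[a + δ, b) × ℝ³` and the
time-Lipschitz modulus of `Dᵏu(·)(x)` there, uniformly over all such fields
(`exists_norm_iteratedFDeriv_le_of_bounded`, `exists_lipschitz_time_of_bounded`). Fields defined on
all of `ℝ × ℝ³` ("eternal") are therefore smooth and divergence free everywhere
(`contDiff_of_eternal`, `isDivFree_of_eternal`).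
-/

noncomputable section

-- the summit and its single problem share the name (D-0017 nested layout)
set_option linter.dupNamespace false

open MeasureTheory Set Function Filter TopologicalSpace Metric
open scoped Topology NNReal ENNReal

namespace Summit.NavierStokesRegularity.NavierStokesRegularity.Theorems.TypeIliouvilleNoTypeII.ImmortalZoom

open Literature.Analysis Literature.Analysis.FluidPDE
open Summit.NavierStokesRegularity.NavierStokesRegularity.Theorems

section Window

variable {N A B : ℝ} {u : ℝ → EuclideanSpace ℝ (Fin 3) → EuclideanSpace ℝ (Fin 3)}

/-- **A continuous bounded Oseen-mild field on `(A, B)` is a restarted bounded mild field on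
every window `(a, b)`, `A < a < b < B`** (KNSS 2009, §4 (i)): the clamped shift
`V τ x = u (max a (min (τ + a) b)) x` satisfies `IsKNSSDriftMild (b - a) N V 0` (only the values
of `u` at times of `[a, b] ⊆ (A, B)` enter). [cite: KochNadirashviliSereginSverak2009, §4 (i) (arXiv:0709.3599v1 p. 8)] -/
theorem isKNSSDriftMild_window_of_bounded (hc : ContinuousOn (uncurry u) (Ioo A B ×ˢ univ))
    (hdiv : ∀ t ∈ Ioo A B, IsWeaklyDivFree (u t))
    (hmild : ∀ s t : ℝ, A < s → s < t → t < B → ∀ x,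
      u t x = UnboundedOperators.heatExtension (u s) (t - s) x - oseenDuhamel 1 s u u t x)
    (hbd : ∀ t ∈ Ioo A B, ∀ x, ‖u t x‖ ≤ N) {a b : ℝ} (hAa : A < a) (hab : a < b) (hbB : b < B) :
    IsKNSSDriftMild (b - a) N (fun τ x => u (max a (min (τ + a) b)) x) 0 := by
  obtain ⟨hκc, hκmem, hκid⟩ := clampShift_facts hab.le
  have hbI : b ∈ Ioo A B := ⟨hAa.trans hab, hbB⟩
  have hN0 : 0 ≤ N := (norm_nonneg _).trans (hbd b hbI 0)
  have hκI : ∀ τ, max a (min (τ + a) b) ∈ Ioo A B := fun τ =>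
    ⟨hAa.trans_le (hκmem τ).1, (hκmem τ).2.trans_lt hbB⟩
  have hcont : Continuous (uncurry fun τ x => u (max a (min (τ + a) b)) x) := by
    have hmap : Continuous fun p : ℝ × EuclideanSpace ℝ (Fin 3) =>
        (max a (min (p.1 + a) b), p.2) :=
      (hκc.comp continuous_fst).prodMk continuous_snd
    have hinto : ∀ p : ℝ × EuclideanSpace ℝ (Fin 3),
        (max a (min (p.1 + a) b), p.2) ∈ Ioo A B ×ˢ (univ : Set (EuclideanSpace ℝ (Fin 3))) :=
      fun p => ⟨hκI p.1, mem_univ _⟩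
    exact (hc.comp_continuous hmap hinto).congr fun p => rfl
  have hslice : ∀ t ∈ Ioo A B, Continuous (u t) := fun t ht =>
    hc.comp_continuous (Continuous.prodMk_right t) fun x => ⟨ht, mem_univ x⟩
  have hbd' : ∀ τ ∈ Ioo 0 (b - a), ∀ x, ‖u (max a (min (τ + a) b)) x‖ ≤ N :=
    fun τ _ x => hbd _ (hκI τ) x
  refine IsKNSSDriftMild.mk measurable_const (fun t => by simpa using hN0) hcont.measurable hbd'
    ?_ ?_
  · exact Eventually.of_forall fun τ => hdiv _ (hκI τ)
  · intro s t hs hst htT x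
    have hsid : max a (min (s + a) b) = s + a := hκid s ⟨hs.le, (hst.trans htT).le⟩
    have htid : max a (min (t + a) b) = t + a := hκid t ⟨(hs.trans hst).le, htT.le⟩
    have hVm : ∀ σ ∈ Ioo s t, Measurable fun x => u (max a (min (σ + a) b)) x := fun σ _ =>
      (hslice _ (hκI σ)).measurable
    have hVN : ∀ σ ∈ Ioo s t, ∀ y, ‖u (max a (min (σ + a) b)) y‖ ≤ N :=
      fun σ _ y => hbd _ (hκI σ) y
    rw [driftDuhamel_zero_eq_oseenDuhamel finrank_euclideanSpace_fin hVm hVN hst.le x]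
    have hcongr : ∀ τ ∈ Ioo s t, (fun x => u (max a (min (τ + a) b)) x) = (fun σ => u (σ + a)) τ :=
      fun τ hτ => by
        funext y
        rw [hκid τ ⟨(hs.trans hτ.1).le, (hτ.2.trans htT).le⟩]
    rw [oseenDuhamel_congr_Ioo hcongr hcongr x, oseenDuhamel_translate]
    simp only [hsid, htid]
    have h := hmild (s + a) (t + a) (by linarith) (by linarith) (by linarith) x
    rwa [show t + a - (s + a) = t - s by ring] at h

/-- **Joint smoothness on a window** `(a, b)`, `A < a < b < B`, of a continuous bounded
Oseen-mild field on `(A, B)` (KNSS 2009, Prop. 4.1 via `KNSS2009_prop41_mild_holds`, transported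
back along the shift `t ↦ t - a`). [cite: KochNadirashviliSereginSverak2009, Prop. 4.1 (arXiv:0709.3599v1 p. 8)] -/
theorem isSmoothSpaceTimeOn_window_of_bounded (hc : ContinuousOn (uncurry u) (Ioo A B ×ˢ univ))
    (hdiv : ∀ t ∈ Ioo A B, IsWeaklyDivFree (u t))
    (hmild : ∀ s t : ℝ, A < s → s < t → t < B → ∀ x,
      u t x = UnboundedOperators.heatExtension (u s) (t - s) x - oseenDuhamel 1 s u u t x)
    (hbd : ∀ t ∈ Ioo A B, ∀ x, ‖u t x‖ ≤ N) {a b : ℝ} (hAa : A < a) (hab : a < b) (hbB : b < B) :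
    IsSmoothSpaceTimeOn (Ioo a b) u := by
  obtain ⟨-, -, hκid⟩ := clampShift_facts hab.le
  have hK := isKNSSDriftMild_window_of_bounded hc hdiv hmild hbd hAa hab hbB
  obtain ⟨ε, -, Cst, -, hP⟩ := KNSS2009_prop41_mild_holds 0
  obtain ⟨hsm, -⟩ := hP hK
  have hmap : ContDiff ℝ ((⊤ : ℕ∞) : WithTop ℕ∞)
      fun p : ℝ × EuclideanSpace ℝ (Fin 3) => (p.1 - a, p.2) :=
    (contDiff_fst.sub contDiff_const).prodMk contDiff_snd
  have hinto : MapsTo (fun p : ℝ × EuclideanSpace ℝ (Fin 3) => (p.1 - a, p.2)) (Ioo a b ×ˢ univ)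
      (Ioo 0 (b - a) ×ˢ univ) := by
    rintro ⟨t, x⟩ ⟨ht, -⟩
    exact ⟨⟨by linarith [ht.1], by linarith [ht.2]⟩, mem_univ _⟩
  have hcomp := hsm.comp hmap.contDiffOn hinto
  refine hcomp.congr ?_
  rintro ⟨t, x⟩ ⟨ht, -⟩
  simp only [comp_apply, uncurry_apply_pair]
  rw [hκid (t - a) ⟨by linarith [ht.1], by linarith [ht.2]⟩, sub_add_cancel]

/-- **Joint smoothness on the whole domain** `(A, B) × ℝ³` of a continuous bounded Oseen-mild
field on `(A, B)` (smoothness is local; every `A < t < B` lies in a window `(a, b)` with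
`A < a < t < b < B`). [cite: KochNadirashviliSereginSverak2009, Prop. 4.1 (arXiv:0709.3599v1 p. 8)] -/
theorem contDiffOn_of_bounded (hc : ContinuousOn (uncurry u) (Ioo A B ×ˢ univ))
    (hdiv : ∀ t ∈ Ioo A B, IsWeaklyDivFree (u t))
    (hmild : ∀ s t : ℝ, A < s → s < t → t < B → ∀ x,
      u t x = UnboundedOperators.heatExtension (u s) (t - s) x - oseenDuhamel 1 s u u t x)
    (hbd : ∀ t ∈ Ioo A B, ∀ x, ‖u t x‖ ≤ N) :
    ContDiffOn ℝ (⊤ : ℕ∞) (uncurry u) (Ioo A B ×ˢ univ) := by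
  refine contDiffOn_of_locally_contDiffOn ?_
  rintro ⟨t, x⟩ ⟨ht, -⟩
  have htA : A < t := ht.1
  have htB : t < B := ht.2
  refine ⟨Ioo ((A + t) / 2) ((t + B) / 2) ×ˢ univ, isOpen_Ioo.prod isOpen_univ,
    ⟨⟨by linarith, by linarith⟩, mem_univ _⟩, ?_⟩
  have h := isSmoothSpaceTimeOn_window_of_bounded hc hdiv hmild hbd (a := (A + t) / 2)
    (b := (t + B) / 2) (by linarith) (by linarith) (by linarith)
  exact ContDiffOn.mono h inter_subset_right

/-- **Divergence-freeness at every time** of a continuous bounded Oseen-mild field on `(A, B)`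
with weakly divergence-free slices (the slices are smooth, `isDivFree_of_ae_isWeaklyDivFree_of_smooth`). [folklore] -/
theorem isDivFree_of_bounded (hc : ContinuousOn (uncurry u) (Ioo A B ×ˢ univ))
    (hdiv : ∀ t ∈ Ioo A B, IsWeaklyDivFree (u t))
    (hmild : ∀ s t : ℝ, A < s → s < t → t < B → ∀ x,
      u t x = UnboundedOperators.heatExtension (u s) (t - s) x - oseenDuhamel 1 s u u t x)
    (hbd : ∀ t ∈ Ioo A B, ∀ x, ‖u t x‖ ≤ N) {t : ℝ} (ht : t ∈ Ioo A B) :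
    VectorCalculus.IsDivFree (u t) := by
  have htA : A < t := ht.1
  have htB : t < B := ht.2
  have hsm := isSmoothSpaceTimeOn_window_of_bounded hc hdiv hmild hbd (a := (A + t) / 2)
    (b := (t + B) / 2) (by linarith) (by linarith) (by linarith)
  exact isDivFree_of_ae_isWeaklyDivFree_of_smooth hsm
    ((ae_restrict_mem measurableSet_Ioo).mono fun τ hτ =>
      hdiv τ ⟨by linarith [hτ.1], by linarith [hτ.2]⟩)
    ⟨by linarith, by linarith⟩

/-! ### Uniform bounds over all fields with the same bound `N` -/

/-- **Uniform bounds for all `x`-derivatives on a window** (KNSS 2009, (4.10) via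
`KNSSBootstrap.exists_norm_iteratedFDeriv_slice_le`): for `N`, `k`, a window `a < b` and a margin
`δ > 0` there is `K = K(N, k, a, b, δ)` with `‖Dᵏu(t)(x)‖ ≤ K` for all `t ∈ [a + δ, b)`, all `x`,
and **all** continuous Oseen-mild fields `u` on `(A, B) ⊇ [a, b]` bounded by `N`. [cite: KochNadirashviliSereginSverak2009, §4 (4.10) with Prop. 4.1 (4.6) (arXiv:0709.3599v1 p. 8)] -/
theorem exists_norm_iteratedFDeriv_le_of_bounded (N : ℝ) (k : ℕ) {a b δ : ℝ} (hab : a < b)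
    (hδ : 0 < δ) :
    ∃ K : ℝ, ∀ ⦃A B : ℝ⦄ ⦃u : ℝ → EuclideanSpace ℝ (Fin 3) → EuclideanSpace ℝ (Fin 3)⦄,
      A < a → b < B →
      ContinuousOn (uncurry u) (Ioo A B ×ˢ univ) →
      (∀ t ∈ Ioo A B, IsWeaklyDivFree (u t)) →
      (∀ s t : ℝ, A < s → s < t → t < B → ∀ x,
        u t x = UnboundedOperators.heatExtension (u s) (t - s) x - oseenDuhamel 1 s u u t x) →
      (∀ t ∈ Ioo A B, ∀ x, ‖u t x‖ ≤ N) →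
      ∀ t ∈ Ico (a + δ) b, ∀ x, ‖iteratedFDeriv ℝ k (u t) x‖ ≤ K := by
  obtain ⟨Cf, hCf⟩ := KNSSBootstrap.exists_norm_iteratedFDeriv_slice_le
    (E := EuclideanSpace ℝ (Fin 3))
    finrank_euclideanSpace_fin (T := b - a) (N := N) k
  refine ⟨Cf δ, fun A B u hAa hbB hc hdiv hmild hbd t ht x => ?_⟩
  obtain ⟨-, -, hκid⟩ := clampShift_facts hab.le
  have hK := isKNSSDriftMild_window_of_bounded hc hdiv hmild hbd hAa hab hbB
  have h : ‖iteratedFDeriv ℝ k (fun y => u (max a (min (t - a + a) b)) y) x‖ ≤ Cf δ :=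
    hCf hK δ hδ (t - a) ⟨by linarith [ht.1], by linarith [ht.2]⟩ x
  have hV : (fun y => u (max a (min (t - a + a) b)) y) = u t := by
    funext y; rw [hκid (t - a) ⟨by linarith [ht.1], by linarith [ht.2]⟩, sub_add_cancel]
  rwa [hV] at h

/-- **Uniform time-Lipschitz bounds for all `x`-derivatives on a window** (KNSS 2009, (4.11)
via `KNSSBootstrap.exists_lipschitz_time_iteratedFDeriv`): for `N`, `k`, `a < b`, `δ > 0` there
is `L = L(N, k, a, b, δ) ≥ 0` with `‖Dᵏu(t)(x) − Dᵏu(s)(x)‖ ≤ L |t − s|` for all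
`s, t ∈ [a + δ, b)`, all `x`, and all continuous Oseen-mild fields `u` on `(A, B) ⊇ [a, b]`
bounded by `N`. [cite: KochNadirashviliSereginSverak2009, §4 (4.11) (arXiv:0709.3599v1 p. 8)] -/
theorem exists_lipschitz_time_of_bounded (N : ℝ) (k : ℕ) {a b δ : ℝ} (hab : a < b) (hδ : 0 < δ) :
    ∃ L : ℝ, 0 ≤ L ∧ ∀ ⦃A B : ℝ⦄ ⦃u : ℝ → EuclideanSpace ℝ (Fin 3) → EuclideanSpace ℝ (Fin 3)⦄,
      A < a → b < B →
      ContinuousOn (uncurry u) (Ioo A B ×ˢ univ) →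
      (∀ t ∈ Ioo A B, IsWeaklyDivFree (u t)) →
      (∀ s t : ℝ, A < s → s < t → t < B → ∀ x,
        u t x = UnboundedOperators.heatExtension (u s) (t - s) x - oseenDuhamel 1 s u u t x) →
      (∀ t ∈ Ioo A B, ∀ x, ‖u t x‖ ≤ N) →
      ∀ s ∈ Ico (a + δ) b, ∀ t ∈ Ico (a + δ) b, ∀ x,
        ‖iteratedFDeriv ℝ k (u t) x - iteratedFDeriv ℝ k (u s) x‖ ≤ L * |t - s| := by
  obtain ⟨L, hL0, hL⟩ := KNSSBootstrap.exists_lipschitz_time_iteratedFDeriv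
    (E := EuclideanSpace ℝ (Fin 3))
    finrank_euclideanSpace_fin (T := b - a) (N := N) k hδ
  refine ⟨L, hL0, fun A B u hAa hbB hc hdiv hmild hbd s hs t ht x => ?_⟩
  obtain ⟨-, -, hκid⟩ := clampShift_facts hab.le
  have hK := isKNSSDriftMild_window_of_bounded hc hdiv hmild hbd hAa hab hbB
  have h : ‖iteratedFDeriv ℝ k (fun y => u (max a (min (t - a + a) b)) y) x -
      iteratedFDeriv ℝ k (fun y => u (max a (min (s - a + a) b)) y) x‖ ≤ L * |t - a - (s - a)| :=
    hL hK (s - a) ⟨by linarith [hs.1], by linarith [hs.2]⟩ (t - a)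
      ⟨by linarith [ht.1], by linarith [ht.2]⟩ x
  have hVt : (fun y => u (max a (min (t - a + a) b)) y) = u t := by
    funext y; rw [hκid (t - a) ⟨by linarith [ht.1], by linarith [ht.2]⟩, sub_add_cancel]
  have hVs : (fun y => u (max a (min (s - a + a) b)) y) = u s := by
    funext y; rw [hκid (s - a) ⟨by linarith [hs.1], by linarith [hs.2]⟩, sub_add_cancel]
  rwa [hVt, hVs, show t - a - (s - a) = t - s by ring] at h

end Window

/-! ### Eternal fields -/

section Eternal

variable {N : ℝ} {u : ℝ → EuclideanSpace ℝ (Fin 3) → EuclideanSpace ℝ (Fin 3)}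

/-- **A continuous bounded eternal Oseen-mild field is smooth on all of `ℝ × ℝ³`** (every time
lies in the window `(t - 1, t + 1)`; KNSS 2009, Prop. 4.1). [cite: KochNadirashviliSereginSverak2009, Prop. 4.1 (arXiv:0709.3599v1 p. 8)] -/
theorem contDiff_of_eternal (hc : Continuous (uncurry u)) (hdiv : ∀ t, IsWeaklyDivFree (u t))
    (hmild : ∀ s t : ℝ, s < t → ∀ x,
      u t x = UnboundedOperators.heatExtension (u s) (t - s) x - oseenDuhamel 1 s u u t x)
    (hbd : ∀ t x, ‖u t x‖ ≤ N) : ContDiff ℝ (⊤ : ℕ∞) (uncurry u) := by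
  rw [← contDiffOn_univ]
  refine contDiffOn_of_locally_contDiffOn ?_
  rintro ⟨t, x⟩ -
  refine ⟨Ioo (t - 1) (t + 1) ×ˢ univ, isOpen_Ioo.prod isOpen_univ,
    ⟨⟨by linarith, by linarith⟩, mem_univ _⟩, ?_⟩
  rw [univ_inter]
  exact contDiffOn_of_bounded (A := t - 1) (B := t + 1) hc.continuousOn (fun τ _ => hdiv τ)
    (fun s τ _ hsτ _ y => hmild s τ hsτ y) (fun τ _ y => hbd τ y)

/-- **A continuous bounded eternal Oseen-mild field with weakly divergence-free slices is
divergence free at every time.** [folklore] -/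
theorem isDivFree_of_eternal (hc : Continuous (uncurry u)) (hdiv : ∀ t, IsWeaklyDivFree (u t))
    (hmild : ∀ s t : ℝ, s < t → ∀ x,
      u t x = UnboundedOperators.heatExtension (u s) (t - s) x - oseenDuhamel 1 s u u t x)
    (hbd : ∀ t x, ‖u t x‖ ≤ N) (t : ℝ) : VectorCalculus.IsDivFree (u t) :=
  isDivFree_of_bounded (A := t - 1) (B := t + 1) hc.continuousOn (fun τ _ => hdiv τ)
    (fun s τ _ hsτ _ y => hmild s τ hsτ y) (fun τ _ y => hbd τ y) ⟨by linarith, by linarith⟩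

end Eternal

/-! ### Registered tools stub -/

/-- **Registered tools stub of the line `Sketch` (crux `TypeIliouvilleNoTypeII`,
stmt-NavierStokesRegularity-0056)**: the conjunction of this file's exported lemmas — window-uniform
`Cᵏ` bounds and time-Lipschitz bounds for bounded Oseen-mild fields, joint smoothness on the
window, and smoothness / divergence-freeness of bounded eternal Oseen-mild fields. [cite: KochNadirashviliSereginSverak2009, Prop. 4.1 with (4.10)–(4.11) (arXiv:0709.3599v1 p. 8)] -/
theorem stub_activeWindowsRegularityTools :
    (∀ (N : ℝ) (k : ℕ) (a b δ : ℝ), a < b → 0 < δ →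
      ∃ K : ℝ, ∀ ⦃A B : ℝ⦄ ⦃u : ℝ → EuclideanSpace ℝ (Fin 3) → EuclideanSpace ℝ (Fin 3)⦄,
        A < a → b < B →
        ContinuousOn (uncurry u) (Ioo A B ×ˢ univ) →
        (∀ t ∈ Ioo A B, IsWeaklyDivFree (u t)) →
        (∀ s t : ℝ, A < s → s < t → t < B → ∀ x,
          u t x = UnboundedOperators.heatExtension (u s) (t - s) x - oseenDuhamel 1 s u u t x) →
        (∀ t ∈ Ioo A B, ∀ x, ‖u t x‖ ≤ N) →
        ∀ t ∈ Ico (a + δ) b, ∀ x, ‖iteratedFDeriv ℝ k (u t) x‖ ≤ K) ∧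
    (∀ (N : ℝ) (k : ℕ) (a b δ : ℝ), a < b → 0 < δ →
      ∃ L : ℝ, 0 ≤ L ∧ ∀ ⦃A B : ℝ⦄ ⦃u : ℝ → EuclideanSpace ℝ (Fin 3) → EuclideanSpace ℝ (Fin 3)⦄,
        A < a → b < B →
        ContinuousOn (uncurry u) (Ioo A B ×ˢ univ) →
        (∀ t ∈ Ioo A B, IsWeaklyDivFree (u t)) →
        (∀ s t : ℝ, A < s → s < t → t < B → ∀ x,
          u t x = UnboundedOperators.heatExtension (u s) (t - s) x - oseenDuhamel 1 s u u t x) →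
        (∀ t ∈ Ioo A B, ∀ x, ‖u t x‖ ≤ N) →
        ∀ s ∈ Ico (a + δ) b, ∀ t ∈ Ico (a + δ) b, ∀ x,
          ‖iteratedFDeriv ℝ k (u t) x - iteratedFDeriv ℝ k (u s) x‖ ≤ L * |t - s|) ∧
    (∀ (N A B : ℝ) (u : ℝ → EuclideanSpace ℝ (Fin 3) → EuclideanSpace ℝ (Fin 3)),
        ContinuousOn (uncurry u) (Ioo A B ×ˢ univ) →
        (∀ t ∈ Ioo A B, IsWeaklyDivFree (u t)) →
        (∀ s t : ℝ, A < s → s < t → t < B → ∀ x,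
          u t x = UnboundedOperators.heatExtension (u s) (t - s) x - oseenDuhamel 1 s u u t x) →
        (∀ t ∈ Ioo A B, ∀ x, ‖u t x‖ ≤ N) →
        ContDiffOn ℝ (⊤ : ℕ∞) (uncurry u) (Ioo A B ×ˢ univ)) ∧
    (∀ (N : ℝ) (u : ℝ → EuclideanSpace ℝ (Fin 3) → EuclideanSpace ℝ (Fin 3)),
        Continuous (uncurry u) → (∀ t, IsWeaklyDivFree (u t)) →
        (∀ s t : ℝ, s < t → ∀ x,
          u t x = UnboundedOperators.heatExtension (u s) (t - s) x - oseenDuhamel 1 s u u t x) →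
        (∀ t x, ‖u t x‖ ≤ N) → ContDiff ℝ (⊤ : ℕ∞) (uncurry u)) ∧
    (∀ (N : ℝ) (u : ℝ → EuclideanSpace ℝ (Fin 3) → EuclideanSpace ℝ (Fin 3)),
        Continuous (uncurry u) → (∀ t, IsWeaklyDivFree (u t)) →
        (∀ s t : ℝ, s < t → ∀ x,
          u t x = UnboundedOperators.heatExtension (u s) (t - s) x - oseenDuhamel 1 s u u t x) →
        (∀ t x, ‖u t x‖ ≤ N) → ∀ t, VectorCalculus.IsDivFree (u t)) :=
  ⟨fun N k _ _ _ hab hδ => exists_norm_iteratedFDeriv_le_of_bounded N k hab hδ,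
    fun N k _ _ _ hab hδ => exists_lipschitz_time_of_bounded N k hab hδ,
    fun _ _ _ _ hc hdiv hmild hbd => contDiffOn_of_bounded hc hdiv hmild hbd,
    fun _ _ hc hdiv hmild hbd => contDiff_of_eternal hc hdiv hmild hbd,
    fun _ _ hc hdiv hmild hbd => isDivFree_of_eternal hc hdiv hmild hbd⟩

end Summit.NavierStokesRegularity.NavierStokesRegularity.Theorems.TypeIliouvilleNoTypeII.ImmortalZoom

end
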